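import Summits.BirchSwinnertonDyer.BirchSwinnertonDyer.Theorems.BiquadraticEisensteinDescentHeegnerTwistCouplingInSupplySylvesterTwistPhiHatValuations
import HarnessLib

set_option linter.dupNamespace false -- `Summit.BirchSwinnertonDyer.BirchSwinnertonDyer.Theorems.…` (summit = sub, D-0017)
set_option autoImplicit false

/-!
# Crux `HeegnerTwistCouplingInSupply` (stmt-BirchSwinnertonDyer-21381) — programme «TWISTED 3-ISOGENY DESCENT», file P5a:
# the `φ`-side over the REAL Kummer field `F = ℚ(√6)`: valuations of norm-cube Ш-parameters of `E_F : y² = x³ − 2p²`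

Route `BiquadraticEisensteinDescent` (cell `pub/bsd-wall`, width seat `bsd-wall-cm-bed-w4` g32; `--supports` 21381, helper). For the
Sylvester twist `E : y² = x³ − 2p²` over `ℚ` the kernel `{O, (0, ±p√−2)}` of `φ` is `μ₃` over `F = ℚ(√6) ∋ ω` (`ω² = 6`;
`√−2 = ω√−3/3`): over `F`, `E_F = mordellCurve(−3c″²)` with `c″ = pω/3`, partner `Y² = X³ + 81c″² = X³ + 54p²`,
`phiDescent c″ P = Y + 3pω`. For a class
`[C_u] ∈ Ш(E_F/F)` with `u · c(u) = r³` (`c` the non-trivial automorphism of `F`, `r` fixed):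

* §1 ★ `three_dvd_log_valuation_of_good_phi` — `3 ∣ v(u)` at every `v ∌ 2, 3, p` (local necessity + descent valuations, `6pω` a `v`-unit);
* §2 `three_dvd_log_valuation_of_smul_eq` — at a `c`-FIXED place the norm-cube relation `3 ∣ v(u) + (c • v)(u)` gives `3 ∣ v(u)`;
  ★ `smul_eq_of_forall_padic_sq_ne` — a place `v ∋ ℓ` with `c • v ≠ v` has `e = f = 1`, so `F_v ≅ ℚ_ℓ ∋ √6`; hence `c • v = v` as
  soon as `6 ∉ ℚ_ℓ²`: `padic_sq_ne_six_two` (`ord₂ 6 = 1`), `padic_sq_ne_six_three` (`ord₃ 6 = 1`), `padic_sq_ne_six_of_not_isSquare` (`6` a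
  non-residue mod `ℓ ∤ 6`) — the places over `2`, `3` (ramified) and over an inert `p`;
* §3 `emod_three_eq_one_of_sq_eq_neg_three`, ★ `not_isSquare_six_zmod` — `(6/p) = −1` for `p ≡ 8 (mod 9)`, `p = a² + 2b²`;
* §4 ★★ `three_dvd_log_valuation_phi` — ALL valuations of `u` are divisible by `3`.

HONEST FRAMING: valuation half of the `φ`-side box for ONE CM family; the local analysis at the inert `p` (P5b), the box (P5c), the
assembly and BSD are untouched. THEOREMS ONLY (no `def`, no named fact, no sorry). Supports stmt-BirchSwinnertonDyer-21381.
[cite: SilvermanAEC2009, Thm. X.4.2 (a), Prop. X.4.9, Thm. X.1.1 (c)] [cite: CohenPazuki2009, Definition 1.3 (G₃), Proposition 2.2]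
[cite: FrohlichTaylor1990, Ch. III §1 (1.14)(a), Thm. 20] [cite: CasselsFrohlichANT1967, Ch. VII §1.1]
-/

noncomputable section

open scoped Classical WithZero Pointwise

namespace Summit.BirchSwinnertonDyer.BirchSwinnertonDyer.Theorems.SylvesterTwistDescent

open Literature.NumberTheory.EllipticCurves Literature.NumberTheory.EllipticCurves.MordellDescent
open Literature.NumberTheory.NumberFields IsDedekindDomain IsDedekindDomain.HeightOneSpectrum NumberField
open Literature.NumberTheory.Automorphic Literature.NumberTheory.QuadraticFields
open WithZero (log exp)

variable {F : Type} [Field F] [NumberField F] (hF2 : Module.finrank ℚ F = 2) {ω : F} (hω : ω ^ 2 = 6)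
  (c : F ≃ₐ[ℚ] F) {p : ℕ} (hc' : (p * ω / 3 : F) ≠ 0) {D : F} (hD : D = -3 * (p * ω / 3) ^ 2)
  {u : F} (hu : u ≠ 0) (hsha : torsorClass hc' hD hu ∈ (mordellCurve D).sha)

/-! ## §0 Descent valuations (private copies; the tree's `MordellCurveCubicDescentValuation` has no farm build) -/

/-- `a b = x³`, `v(a − b) = 1`, `a, b ≠ 0` ⟹ `ord_v(a) ∈ 3ℤ`. [cite: SilvermanAEC2009, Thm. X.1.1(c)] -/
private theorem exists_log_eq_three_mul_of_mul_eq_cube' {L : Type*} [Field L] (w : Valuation L ℤᵐ⁰) {a b x : L} (ha : a ≠ 0)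
    (hb : b ≠ 0) (hsub : w (a - b) = 1) (h : a * b = x ^ 3) : ∃ k : ℤ, log (w a) = 3 * k := by
  have hva : w a ≠ 0 := (w.ne_zero_iff).mpr ha
  have hvb : w b ≠ 0 := (w.ne_zero_iff).mpr hb
  have hx : x ≠ 0 := by
    rintro rfl
    rw [zero_pow three_ne_zero, mul_eq_zero] at h
    exact h.elim ha hb
  have hprod : w a * w b = w x ^ 3 := by rw [← map_mul, h, map_pow]
  by_cases hab : w a = w b
  · have key : w a ^ 2 = w x ^ 3 := by rw [sq, ← hprod, hab]
    have hlog := congrArg WithZero.log key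
    rw [WithZero.log_pow, WithZero.log_pow, nsmul_eq_mul, nsmul_eq_mul] at hlog
    push_cast at hlog
    exact ⟨log (w a) - log (w x), by linarith⟩
  · have hmax : max (w a) (w b) = 1 := by
      have := w.map_add_of_distinct_val (x := a) (y := -b) (by rwa [Valuation.map_neg])
      rw [← sub_eq_add_neg, hsub, Valuation.map_neg] at this
      exact this.symm
    rcases lt_or_gt_of_ne hab with hlt | hlt
    · have hb1 : w b = 1 := by rw [max_eq_right hlt.le] at hmax; exact hmax
      rw [hb1, mul_one] at hprod
      have hlog := congrArg WithZero.log hprod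
      rw [WithZero.log_pow, nsmul_eq_mul] at hlog
      push_cast at hlog
      exact ⟨log (w x), by linarith⟩
    · have ha1 : w a = 1 := by rw [max_eq_left hlt.le] at hmax; exact hmax
      exact ⟨0, by rw [ha1, WithZero.log_one]; ring⟩

/-- `ord_v(phiDescent c P) ∈ 3ℤ` for every point `P` of `Y² = X³ + 81c²` when `v(18c) = 1`. [cite: SilvermanAEC2009, Thm. X.1.1(c)] -/
private theorem exists_log_phiDescent_eq_three_mul' {L : Type*} [Field L] [CharZero L] (w : Valuation L ℤᵐ⁰) {c₀ : L}
    (hv : w (2 * (9 * c₀)) = 1) (P : (mordellCurve (81 * c₀ ^ 2)).toAffine.Point) :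
    ∃ k : ℤ, log (w (phiDescent c₀ P)) = 3 * k := by
  have h2B : (2 : L) * (9 * c₀) ≠ 0 := fun h0 ↦ by rw [h0, map_zero] at hv; exact zero_ne_one hv
  have hW : mordellCurve (81 * c₀ ^ 2) = mordellCurve ((9 * c₀) ^ 2) := by congr 1; ring
  rw [phiDescent_eq_cubicDescent]
  rcases P with _ | ⟨X, Y, hP⟩
  · exact ⟨0, by rw [← WeierstrassCurve.Affine.Point.zero_def, cubicDescent_zero, map_one, WithZero.log_one]; ring⟩
  · have hE : Y ^ 2 = X ^ 3 + (9 * c₀) ^ 2 := (equation_iff_of_eq hW X Y).mp hP.1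
    rw [cubicDescent_some]
    split_ifs with hY
    · exact ⟨0, by rw [map_pow, hv, one_pow, WithZero.log_one]; ring⟩
    · by_cases hX : X = 0
      · have hYB : Y = 9 * c₀ := by
          rcases y_eq_or_of_x_eq_zero hW hP.1 hX with h | h
          · exact h
          · exact absurd h hY
        exact ⟨0, by rw [hYB, ← two_mul, hv, WithZero.log_one]; ring⟩
      · refine exists_log_eq_three_mul_of_mul_eq_cube' w (b := Y - 9 * c₀) (x := X) (fun h ↦ hY ?_) (fun h ↦ hX ?_)
          (by rw [show Y + 9 * c₀ - (Y - 9 * c₀) = 2 * (9 * c₀) by ring, hv]) ?_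
        · linear_combination h
        · have : X ^ 3 = 0 := by
            have hYB : Y = 9 * c₀ := by linear_combination h
            rw [hYB] at hE; linear_combination hE.symm
          exact pow_eq_zero_iff three_ne_zero |>.mp this
        · linear_combination hE

/-! ## §1 Good places -/

include hω in
omit [NumberField F] in
/-- `ω` is integral (`ω² − 6 = 0`). [cite: Marcus2018, Ch. 2 Cor. 2] -/
private theorem isIntegral_omega : IsIntegral ℤ ω := by
  refine ⟨Polynomial.X ^ 2 - Polynomial.C 6, Polynomial.monic_X_pow_sub_C _ two_ne_zero, ?_⟩
  simp [hω]

include hω in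
/-- `v(ω) = 1` at a place above neither `2` nor `3` (`ω² = 6` is a `v`-unit). [cite: CasselsFrohlichANT1967, Ch. VII §1.1] -/
theorem valuation_omega_eq_one (v : HeightOneSpectrum (𝓞 F)) (h2 : ((2 : ℕ) : 𝓞 F) ∉ v.asIdeal) (h3 : ((3 : ℕ) : 𝓞 F) ∉ v.asIdeal) :
    v.valuation F ω = 1 := by
  set ω' : 𝓞 F := ⟨ω, isIntegral_omega hω⟩ with hω'
  have hωF : (ω : F) = algebraMap (𝓞 F) F ω' := rfl
  have hle : v.valuation F ω ≤ 1 := by rw [hωF]; exact valuation_le_one v ω'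
  have hsq : v.valuation F ω * v.valuation F ω = 1 := by
    rw [← map_mul, ← sq, hω, show (6 : F) = ((2 : ℕ) : F) * ((3 : ℕ) : F) by norm_num, map_mul, valuation_natCast_eq_one v h2,
      valuation_natCast_eq_one v h3, mul_one]
  by_contra hne
  have hlt : v.valuation F ω < 1 := lt_of_le_of_ne hle hne
  have : v.valuation F ω * v.valuation F ω < 1 := by
    calc v.valuation F ω * v.valuation F ω ≤ v.valuation F ω * 1 := by gcongr
      _ = v.valuation F ω := mul_one _
      _ < 1 := hlt
  rw [hsq] at this
  exact lt_irrefl _ this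

include hω hsha in
/-- ★ **`3 ∣ v(u)` at the good places** of the `φ`-side: `[C_u] ∈ Ш(E_F/F)` (`E_F = mordellCurve(−3c″²)`, `c″ = pω/3`) forces, at every
`v ∌ 2, 3, p`, `u·w³ = phiDescent c″ P` for a local point `P` (local necessity), whose valuation is `≡ 0 (mod 3)` since `2·9c″ = 6pω` is a
`v`-unit. [cite: SilvermanAEC2009, Thm. X.4.2 (a), Prop. X.4.9, Thm. X.1.1 (c)] -/
theorem three_dvd_log_valuation_of_good_phi (v : HeightOneSpectrum (𝓞 F)) (h2 : ((2 : ℕ) : 𝓞 F) ∉ v.asIdeal)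
    (h3 : ((3 : ℕ) : 𝓞 F) ∉ v.asIdeal) (hpv : ((p : ℕ) : 𝓞 F) ∉ v.asIdeal) :
    (3 : ℤ) ∣ log (v.valuation F u) := by
  obtain ⟨P, w, hw0, hPw⟩ := exists_phiDescent_eq_adicCompletion_of_torsorClass_mem_sha hc' hD hu hsha v
  haveI : CharZero (v.adicCompletion F) :=
    charZero_of_injective_algebraMap (algebraMap F (v.adicCompletion F)).injective
  have hval : ∀ k : F, Valued.v (algebraMap F (v.adicCompletion F) k) = v.valuation F k :=
    fun k => valuedAdicCompletion_eq_valuation' v k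
  have h2B : Valued.v ((2 : v.adicCompletion F) * (9 * algebraMap F (v.adicCompletion F) (p * ω / 3))) = 1 := by
    have : (2 : v.adicCompletion F) * (9 * algebraMap F (v.adicCompletion F) (p * ω / 3)) =
        algebraMap F (v.adicCompletion F) ((2 : ℕ) * ((3 : ℕ) * ((p : ℕ) * ω))) := by
      simp only [map_mul, map_natCast, map_ofNat, map_div₀]; push_cast; ring
    rw [this, hval, map_mul, map_mul, map_mul, valuation_natCast_eq_one v h2, valuation_natCast_eq_one v h3,
      valuation_natCast_eq_one v hpv, valuation_omega_eq_one hω v h2 h3]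
    simp
  obtain ⟨k, hk⟩ := exists_log_phiDescent_eq_three_mul' (Valued.v : Valuation (v.adicCompletion F) ℤᵐ⁰) h2B P
  rw [hPw, Valuation.map_mul, Valuation.map_pow, hval] at hk
  have hu0 : v.valuation F u ≠ 0 := (Valuation.ne_zero_iff _).mpr hu
  have hw0' : Valued.v w ≠ 0 := (Valuation.ne_zero_iff _).mpr hw0
  rw [WithZero.log_mul hu0 (pow_ne_zero 3 hw0'), WithZero.log_pow, nsmul_eq_mul] at hk
  push_cast at hk
  exact ⟨k - log (Valued.v w), by linarith⟩

/-! ## §2 `c`-fixed places -/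

include hF2 in
/-- At a `c`-fixed place the norm-cube relation gives `3 ∣ v(u)` (`2v(u) = 3v(r)`). [cite: CohenPazuki2009, Definition 1.3 (G₃)] -/
theorem three_dvd_log_valuation_of_smul_eq {u : F} (hu : u ≠ 0) (hnorm : ∃ r : F, c r = r ∧ r ≠ 0 ∧ u * c u = r ^ 3)
    (v : HeightOneSpectrum (𝓞 F)) (hfix : c • v = v) : (3 : ℤ) ∣ log (v.valuation F u) := by
  have h := three_dvd_log_add_log_smul hF2 c hu hnorm v
  rw [hfix, ← two_mul] at h
  have h32 : IsCoprime (3 : ℤ) 2 := by norm_num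
  exact h32.dvd_of_dvd_mul_left h

include hF2 hω in
/-- ★ **A place `v ∋ ℓ` MOVED by `c` would give `√6 ∈ ℚ_ℓ`**: `c • v ≠ v` forces `e(v|ℓ) = f(v|ℓ) = 1`, so `F_v ≅ ℚ_ℓ`, and
`ω ↦ t` with `t² = 6`. Hence `c • v = v` whenever `6 ∉ ℚ_ℓ²`. [cite: FrohlichTaylor1990, Ch. III §1 (1.14)(a), Thm. 20] -/
theorem smul_eq_of_forall_padic_sq_ne {ℓ : ℕ} [Fact ℓ.Prime] (H : ∀ t : ℚ_[ℓ], t ^ 2 ≠ 6) (v : HeightOneSpectrum (𝓞 F))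
    (hℓ : ((ℓ : ℕ) : 𝓞 F) ∈ v.asIdeal) : c • v = v := by
  by_contra hne
  have hℓ' : ((ℓ : ℕ) : 𝓞 F) ∈ (c • v).asIdeal := by
    rw [HeightOneSpectrum.smul_asIdeal]
    have e : c • ((ℓ : ℕ) : 𝓞 F) = ((ℓ : ℕ) : 𝓞 F) := by
      apply RingOfIntegers.ext
      rw [RingOfIntegers.coe_algEquiv_smul, coe_natCast_ringOfIntegers, map_natCast]
    have : c • ((ℓ : ℕ) : 𝓞 F) ∈ c • v.asIdeal := Ideal.smul_mem_pointwise_smul_iff.mpr hℓ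
    rwa [e] at this
  haveI := liesOver_ratPlace_of_natCast_mem F v hℓ
  obtain ⟨he, hf⟩ := ramificationIdx_eq_one_and_inertiaDeg_eq_one_of_natCast_mem_of_ne F hF2 hℓ hℓ' hne
  exact H (padicEquivOfDegreeOne F ℓ v he hf (algebraMap F (v.adicCompletion F) ω))
    (by rw [← map_pow, ← map_pow, hω, map_ofNat, map_ofNat])

/-- `6 ∉ ℚ₂²` (`ord₂ 6 = 1` is odd). [cite: CasselsFrohlichANT1967, Ch. VII §1.1] -/
theorem padic_sq_ne_six_two : ∀ t : ℚ_[2], t ^ 2 ≠ 6 := by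
  intro t ht
  have ht0 : t ≠ 0 := by rintro rfl; norm_num at ht
  have h := congrArg Padic.valuation ht
  rw [sq, Padic.valuation_mul ht0 ht0, show (6 : ℚ_[2]) = ((2 : ℕ) : ℚ_[2]) * ((3 : ℕ) : ℚ_[2]) by norm_num,
    Padic.valuation_mul (by norm_num) (by norm_num), Padic.valuation_natCast, Padic.valuation_natCast,
    show padicValNat 2 2 = 1 from padicValNat_self, padicValNat.eq_zero_of_not_dvd (by norm_num : ¬ 2 ∣ 3)] at h
  omega

/-- `6 ∉ ℚ₃²` (`ord₃ 6 = 1` is odd). [cite: CasselsFrohlichANT1967, Ch. VII §1.1] -/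
theorem padic_sq_ne_six_three : ∀ t : ℚ_[3], t ^ 2 ≠ 6 := by
  haveI : Fact (Nat.Prime 3) := ⟨Nat.prime_three⟩
  intro t ht
  have ht0 : t ≠ 0 := by rintro rfl; norm_num at ht
  have h := congrArg Padic.valuation ht
  rw [sq, Padic.valuation_mul ht0 ht0, show (6 : ℚ_[3]) = ((2 : ℕ) : ℚ_[3]) * ((3 : ℕ) : ℚ_[3]) by norm_num,
    Padic.valuation_mul (by norm_num) (by norm_num), Padic.valuation_natCast, Padic.valuation_natCast,
    padicValNat.eq_zero_of_not_dvd (by norm_num : ¬ 3 ∣ 2), show padicValNat 3 3 = 1 from padicValNat_self] at h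
  omega

/-- `6 ∉ ℚ_ℓ²` for a prime `ℓ ∤ 6` modulo which `6` is a non-residue (`t ∈ ℤ_ℓ`, reduce mod `ℓ`).
[cite: CasselsFrohlichANT1967, Ch. VII §1.1] -/
theorem padic_sq_ne_six_of_not_isSquare {ℓ : ℕ} [Fact ℓ.Prime] (hsq : ¬ IsSquare (6 : ZMod ℓ)) : ∀ t : ℚ_[ℓ], t ^ 2 ≠ 6 := by
  intro t ht
  have h6 : ‖(6 : ℚ_[ℓ])‖ ≤ 1 := by
    rw [show (6 : ℚ_[ℓ]) = ((6 : ℤ) : ℚ_[ℓ]) by norm_cast]; exact Padic.norm_int_le_one 6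
  have ht1 : ‖t‖ ≤ 1 := by
    have : ‖t‖ ^ 2 ≤ 1 := by rw [← norm_pow, ht]; exact h6
    nlinarith [norm_nonneg t]
  set tZ : ℤ_[ℓ] := ⟨t, ht1⟩ with htZ
  have htZ2 : tZ ^ 2 = 6 := by
    apply Subtype.coe_injective
    change t ^ 2 = ((6 : ℤ_[ℓ]) : ℚ_[ℓ])
    rw [ht]; norm_cast
  apply hsq
  exact ⟨PadicInt.toZMod tZ, by rw [← sq, ← map_pow, htZ2, map_ofNat]⟩

include hF2 hω in
/-- **The place over `2` is `c`-fixed** (`2` ramifies in `ℚ(√6)`). [cite: FrohlichTaylor1990, Ch. III §1 Thm. 20] -/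
theorem smul_eq_of_two_mem_phi (v : HeightOneSpectrum (𝓞 F)) (h2 : ((2 : ℕ) : 𝓞 F) ∈ v.asIdeal) : c • v = v :=
  haveI : Fact (Nat.Prime 2) := ⟨Nat.prime_two⟩
  smul_eq_of_forall_padic_sq_ne hF2 hω c padic_sq_ne_six_two v h2

include hF2 hω in
/-- **The place over `3` is `c`-fixed** (`3` ramifies in `ℚ(√6)`). [cite: FrohlichTaylor1990, Ch. III §1 Thm. 20] -/
theorem smul_eq_of_three_mem_phi (v : HeightOneSpectrum (𝓞 F)) (h3 : ((3 : ℕ) : 𝓞 F) ∈ v.asIdeal) : c • v = v :=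
  haveI : Fact (Nat.Prime 3) := ⟨Nat.prime_three⟩
  smul_eq_of_forall_padic_sq_ne hF2 hω c padic_sq_ne_six_three v h3

include hF2 hω in
/-- **A place over an INERT `p` (`(6/p) = −1`) is `c`-fixed.** [cite: FrohlichTaylor1990, Ch. III §1 Thm. 20] -/
theorem smul_eq_of_natCast_mem_of_not_isSquare (hp : p.Prime) (hsq : ¬ IsSquare (6 : ZMod p)) (v : HeightOneSpectrum (𝓞 F))
    (hpv : ((p : ℕ) : 𝓞 F) ∈ v.asIdeal) : c • v = v :=
  haveI : Fact p.Prime := ⟨hp⟩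
  smul_eq_of_forall_padic_sq_ne hF2 hω c (padic_sq_ne_six_of_not_isSquare hsq) v hpv

/-! ## §3 `(6/p) = −1` for `p ≡ 8 (mod 9)`, `p = a² + 2b²` -/

/-- If `−3` is a square modulo a prime `p ≠ 2, 3` then `p ≡ 1 (mod 3)` (`ζ = (x − 1)/2` is a primitive cube root of unity, so
`3 ∣ p − 1`). [cite: IrelandRosen1990, Ch. 9 §1] -/
theorem emod_three_eq_one_of_sq_eq_neg_three {p : ℕ} [Fact p.Prime] (hp2 : p ≠ 2) (hp3 : p ≠ 3) {x : ZMod p} (hx : x ^ 2 = -3) :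
    p % 3 = 1 := by
  have hp : p.Prime := Fact.out
  have h2 : (2 : ZMod p) ≠ 0 := by
    intro h
    have h' : ((2 : ℕ) : ZMod p) = 0 := by exact_mod_cast h
    rw [ZMod.natCast_eq_zero_iff] at h'
    exact hp2 ((Nat.prime_dvd_prime_iff_eq hp Nat.prime_two).mp h')
  obtain ⟨i2, hi2⟩ : ∃ i2 : ZMod p, i2 = (2 : ZMod p)⁻¹ := ⟨_, rfl⟩
  have h22 : 2 * i2 = 1 := by rw [hi2]; exact mul_inv_cancel₀ h2
  obtain ⟨ζ, hζ⟩ : ∃ ζ : ZMod p, ζ = (x - 1) * i2 := ⟨_, rfl⟩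
  have hζ3 : ζ ^ 3 = 1 := by
    rw [hζ]; linear_combination (i2 ^ 3 * (x - 3)) * hx + (4 * i2 ^ 2 + 2 * i2 + 1) * h22
  have hζ1 : ζ ≠ 1 := by
    intro h1
    rw [hζ] at h1
    have hx3 : x = 3 := by linear_combination 2 * h1 + (1 - x) * h22
    have h12 : ((12 : ℕ) : ZMod p) = 0 := by push_cast; linear_combination hx - (x + 3) * hx3
    rw [ZMod.natCast_eq_zero_iff] at h12
    have h12' : p ∣ 2 * 2 * 3 := by norm_num; exact h12
    rcases (Nat.Prime.dvd_mul hp).mp h12' with h | h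
    · rcases (Nat.Prime.dvd_mul hp).mp h with h' | h' <;> exact hp2 ((Nat.prime_dvd_prime_iff_eq hp Nat.prime_two).mp h')
    · exact hp3 ((Nat.prime_dvd_prime_iff_eq hp Nat.prime_three).mp h)
  haveI : Fact (Nat.Prime 3) := ⟨Nat.prime_three⟩
  have hord : orderOf ζ = 3 := orderOf_eq_prime hζ3 hζ1
  have hζ0 : ζ ≠ 0 := by
    intro h0; rw [h0, zero_pow three_ne_zero] at hζ3; exact zero_ne_one hζ3
  have hdvd : 3 ∣ p - 1 := by
    rw [← hord]; exact orderOf_dvd_of_pow_eq_one (ZMod.pow_card_sub_one_eq_one hζ0)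
  have := hp.two_le
  omega

/-- ★ **`(6/p) = −1` for the Sylvester primes**: `p ≡ 8 (mod 9)` and `p = a² + 2b²` (so `(−2/p) = 1`; were `6` a residue, `−3 = 6·(−2)/4`
would be one, forcing `p ≡ 1 (mod 3)`). [cite: IrelandRosen1990, Ch. 9 §1] -/
theorem not_isSquare_six_zmod (hp : p.Prime) (hp9 : p % 9 = 8) {a b : ℤ} (hab : a ^ 2 + 2 * b ^ 2 = p) :
    ¬ IsSquare (6 : ZMod p) := by
  haveI : Fact p.Prime := ⟨hp⟩
  rintro ⟨t, ht⟩
  have hp2 : p ≠ 2 := by omega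
  have hp3 : p ≠ 3 := by omega
  have habp : (a : ZMod p) ^ 2 + 2 * (b : ZMod p) ^ 2 = 0 := by
    have h := congrArg (Int.cast : ℤ → ZMod p) hab
    push_cast at h
    rw [h, ZMod.natCast_self]
  have hb : (b : ZMod p) ≠ 0 := by
    intro hb0
    have ha0 : (a : ZMod p) = 0 := by
      rw [hb0] at habp
      have : (a : ZMod p) ^ 2 = 0 := by simpa using habp
      exact pow_eq_zero_iff two_ne_zero |>.mp this
    have hpa : (p : ℤ) ∣ a := (ZMod.intCast_zmod_eq_zero_iff_dvd a p).mp ha0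
    have hpb : (p : ℤ) ∣ b := (ZMod.intCast_zmod_eq_zero_iff_dvd b p).mp hb0
    have hdvd : (p : ℤ) ^ 2 ∣ (p : ℤ) := by
      have h' : (p : ℤ) ^ 2 ∣ a ^ 2 + 2 * b ^ 2 :=
        dvd_add (pow_dvd_pow_of_dvd hpa 2) (dvd_mul_of_dvd_right (pow_dvd_pow_of_dvd hpb 2) 2)
      rwa [hab] at h'
    have hle : (p : ℤ) ^ 2 ≤ p := Int.le_of_dvd (by exact_mod_cast hp.pos) hdvd
    have h2le : (2 : ℤ) ≤ p := by exact_mod_cast hp.two_le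
    nlinarith
  have h2 : (2 : ZMod p) ≠ 0 := by
    intro h
    have h' : ((2 : ℕ) : ZMod p) = 0 := by exact_mod_cast h
    rw [ZMod.natCast_eq_zero_iff] at h'
    exact hp2 ((Nat.prime_dvd_prime_iff_eq hp Nat.prime_two).mp h')
  obtain ⟨i, hi⟩ : ∃ i : ZMod p, i = (2 * (b : ZMod p))⁻¹ := ⟨_, rfl⟩
  have hinv : 2 * (b : ZMod p) * i = 1 := by rw [hi]; exact mul_inv_cancel₀ (mul_ne_zero h2 hb)
  have hx : (t * a * i) ^ 2 = (-3 : ZMod p) := by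
    linear_combination (-(a : ZMod p) ^ 2 * i ^ 2) * ht + (6 * i ^ 2) * habp + (-3 * (2 * b * i + 1)) * hinv
  have := emod_three_eq_one_of_sq_eq_neg_three hp2 hp3 hx
  omega

/-! ## §4 All valuations are divisible by `3` -/

include hF2 hω hsha in
/-- ★★ **`3 ∣ v(u)` at EVERY finite place** for a norm-cube class `[C_u] ∈ Ш(E_F/F)` of the `φ`-side (`p ≡ 8 (mod 9)`, `p = a² + 2b²`):
good places by §1; the places over `2`, `3` (ramified) and `p` (inert) are `c`-fixed (§2–§3), where the norm relation gives it.
[cite: CohenPazuki2009, Proposition 2.2] [cite: SilvermanAEC2009, Thm. X.4.2 (a)] -/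
theorem three_dvd_log_valuation_phi (hnorm : ∃ r : F, c r = r ∧ r ≠ 0 ∧ u * c u = r ^ 3) (hp : p.Prime) (hp9 : p % 9 = 8) {a b : ℤ}
    (hab : a ^ 2 + 2 * b ^ 2 = p) (v : HeightOneSpectrum (𝓞 F)) : (3 : ℤ) ∣ log (v.valuation F u) := by
  by_cases h2 : ((2 : ℕ) : 𝓞 F) ∈ v.asIdeal
  · exact three_dvd_log_valuation_of_smul_eq hF2 c hu hnorm v (smul_eq_of_two_mem_phi hF2 hω c v h2)
  by_cases h3 : ((3 : ℕ) : 𝓞 F) ∈ v.asIdeal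
  · exact three_dvd_log_valuation_of_smul_eq hF2 c hu hnorm v (smul_eq_of_three_mem_phi hF2 hω c v h3)
  by_cases hpv : ((p : ℕ) : 𝓞 F) ∈ v.asIdeal
  · exact three_dvd_log_valuation_of_smul_eq hF2 c hu hnorm v
      (smul_eq_of_natCast_mem_of_not_isSquare hF2 hω c hp (not_isSquare_six_zmod hp hp9 hab) v hpv)
  exact three_dvd_log_valuation_of_good_phi hω hc' hD hu hsha v h2 h3 hpv

end Summit.BirchSwinnertonDyer.BirchSwinnertonDyer.Theorems.SylvesterTwistDescent

end
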